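import Summits.BirchSwinnertonDyer.BirchSwinnertonDyer.Theorems.SchneiderFreeAdditiveX3PoitouTateShaDualOfReadoutUnramified
import Summits.BirchSwinnertonDyer.BirchSwinnertonDyer.Theorems.SchneiderFreeAdditiveX3PoitouTateReciprocityEqualityHolds
import Summits.BirchSwinnertonDyer.BirchSwinnertonDyer.Theorems.SchneiderFreeAdditiveX3AnticycControlAdditiveKStubBaseCountTors
import HarnessLib

/-!
# The aside `AdditiveControlLeaf` (item stmt-BirchSwinnertonDyer-19451, route `SchneiderFreeAdditiveX3`) BY NAME —
# the pointwise anticyclotomic control equality at an additive prime, under the crux's Kolyvagin antecedent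

Cell `bsd-schneider-ideate`, seat `bsd-schneider-door-c6` (prover, generation 19).  PARTITION: board row B6 ∩ X3 ∩ sst-twist,
`r = 1`, of `Rank1Residual.partition` — CONTROL corner; `AdditiveControlLeaf` is DEFINITIONALLY the crux `AnticycControlAdditiveK`
(item 19295, skeleton v3-K c0242a50) with its socket `SchneiderFree.AdditiveControlInputManinAt W p` unfolded to the pointwise
`SchneiderFree.AdditiveControlOnTreeAt` (critic 2026-08-27: `Iff.rfl`).  bears_on: K1-door (r1, B6∩X3-sst)
(route-BirchSwinnertonDyer-SchneiderFreeAdditiveX3 items 18969 → 19295; aside 19451).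

THE PROOF is pure assembly of TREE THEOREMS of the cell's Route A (doors c4/c5/c6 and bsd-wall chl-p2, 2026-08-26…28):
* PT (ii) `poitouTate_sha_tateDual K` for EVERY number field `K` (Milne *ADT* I Thm. 4.10 (a)) =
  `PoitouTateReduction.poitouTate_sha_tateDual_of_readoutUnramified` (door-c4 g19: Tate duality for `(Γ_K, C̄)`, the idèle
  projections with (R3), `SelmerComplement`, (A) at every `K`, (B), `Ψ`, the (R4) equality) with its ONE named input `hRur`
  (local readouts of an idèle-valued map are unramified almost everywhere, Milne I Lemma 4.13) DISCHARGED by door-c5 g18's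
  `PoitouTateReduction.hRur_holds` (`Finite (TateDual K M n)` supplied by `DiscreteGaloisModule.TateDual.finite`);
* the crux from PT (ii): door-c4 g18's `anticycControlAdditiveK_of_sha_tateDual` (PT (i) = `poitouTate_selmerStructure_duality_holds`
  inside; stubs `stub_kerRes` / `stub_kerLoc` / `stub_localKernelOrder` / `stub_baseCountTors` landed, `stub_ptSurj` / `stub_coinv`
  under the crux's Kolyvagin antecedent — door-c6 g5/g18).
The named closers of items 19295 / 19538 are door-c4 g19's (announce-before-propose, cell STATUS 11:18Z); this file declares only
the aside's closer and keeps PT (ii) as a local term.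

HONEST FRAMING: closes the by-name ASIDE 19451 only (a rung-K1 leaf of BirchSwinnertonDyer, conditional — as typed — on the cite-only
Kolyvagin theorem `Literature.NumberTheory.EllipticCurves.kolyvagin` that the decl carries as antecedent); BSD is NOT proved by this.

References: [JetchevSkinnerWan2017] Thm. 3.3.1, Prop. 3.2.1, §3.3 (arXiv:1512.06894 pp. 10–13); [MilneADT2006] I Thm. 4.10,
Lemma 4.13; [Gross1991] Thm. 1.3.
-/

noncomputable section

set_option linter.dupNamespace false

namespace Summit.BirchSwinnertonDyer.BirchSwinnertonDyer.Theorems.SchneiderFreeAdditiveX3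

open Literature.NumberTheory.GaloisCohomology Literature.NumberTheory.GaloisRepresentations

/-- **The aside `AdditiveControlLeaf` (item stmt-BirchSwinnertonDyer-19451) BY NAME**: under Kolyvagin's theorem, the pointwise
anticyclotomic control equality `SchneiderFree.AdditiveControlOnTreeAt p κ 𝔭 γ (embAt K p 𝔭 …) P` at every B6 ∩ X3 ∩ sst-twist
frame — definitionally the crux `AnticycControlAdditiveK`, obtained from door-c4 g18's `anticycControlAdditiveK_of_sha_tateDual`
fed with PT (ii) for every number field (`poitouTate_sha_tateDual_of_readoutUnramified` ∘ `hRur_holds`).  Conditional, as typed,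
on the cite-only Kolyvagin antecedent; BSD is not proved by this.
[cite: JetchevSkinnerWan2017, Thm. 3.3.1 and §3.3 (arXiv:1512.06894 pp. 11–13)] [cite: MilneADT2006, Ch. I, Thm. 4.10 (a),(b) and Lemma 4.13] -/
theorem additiveControlLeaf_proof :
    Summit.BirchSwinnertonDyer.BirchSwinnertonDyer.Theses.SchneiderFreeAdditiveX3.AdditiveControlLeaf := by
  unfold Summit.BirchSwinnertonDyer.BirchSwinnertonDyer.Theses.SchneiderFreeAdditiveX3.AdditiveControlLeaf
  -- PT (ii) for every number field, as a local term
  have hPT2 : ∀ (K : Type) [Field K] [NumberField K], poitouTate_sha_tateDual K := fun K _ _ =>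
    PoitouTateReduction.poitouTate_sha_tateDual_of_readoutUnramified (K := K)
      fun n _ M _ _ _ _ ρ₀ hM f => by
        haveI := DiscreteGaloisModule.TateDual.finite K M n
        exact PoitouTateReduction.hRur_holds ρ₀ hM f
  exact anticycControlAdditiveK_of_sha_tateDual hPT2

end Summit.BirchSwinnertonDyer.BirchSwinnertonDyer.Theorems.SchneiderFreeAdditiveX3

end
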